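import Summits.Ventures.DiscreteObjects.Hadamard.ConferenceGraph333Order82
import Summits.Ventures.DiscreteObjects.Hadamard.ConferenceGraph333FixedConference

/-!
# Involutions inverting an element of odd prime order of Aut(srg(333,166,82,83)): at most one fixed point per orbit (kernel)

Framing: lottery ticket; floor = certified bounds/negative ranges.  Cell pub-namedobj (venture DiscreteObjects),
target (H) = `H(668)`, hadamard gen 31.  The NORMALISER side of the large-prime local structure (the centraliser side is gen 30's
`Centralizer83` and gen 31's `CentralizingInvolutions` / `Centralizer41`): if `τ` inverts `ρ` (`ρ τ ρ = τ`, i.e. `τ ρ τ⁻¹ = ρ⁻¹`; the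
dihedral relation) and `ρ` has odd prime order `p`, then `τ(ρᵏ y) = ρ⁻ᵏ(τ y)`, so a `ρ`-moved `τ`-fixed vertex `y` is the ONLY `τ`-fixed vertex
of its `⟨ρ⟩`-orbit (`ρ²ᵏ y = y` forces `ρ y = y`):
* `inverting_orbit_no_other_fixed` — `τ y = y`, `ρ y ≠ y`, `0 < k < p` ⇒ `τ (ρᵏ y) ≠ ρᵏ y`;
* **`inverting_fixed_moved_bound`** (pure permutation statement) — `p · #{y : τ y = y, ρ y ≠ y} ≤ #{y : ρ y ≠ y}`;
* for `srg(333,166,82,83)` with the prime windows (`#Fix ρ = 1, 5, 0` for `p = 83, 41, 37`) and the involution law `f ≡ 1 (mod 4)`: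
  **`involution_inverting_order83_fixed`** — `#Fix τ ∈ {1, 5}`; **`involution_inverting_order41_fixed`** — `#Fix τ ∈ {1, 5, 9, 13}`;
  **`involution_inverting_order37_fixed`** — `#Fix τ ∈ {1, 5, 9}`; and `involution_inverting_order11_fixed` — `#Fix τ ≤ 53`
  (general window: `f ≤ 149`, gen 31).
So a dihedral subgroup `D_p = ⟨ρ, τ⟩` of a hypothetical Aut(srg(333,166,82,83)) has its involutions nearly fixed-point-free for `p ∈ {37, 41, 83}`.
WORDS: structure of a HYPOTHETICAL object (nothing about H(668) is excluded); ours (PROVISIONAL).  No `sorry`, no new definitions.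
-/

namespace Summit.Ventures.DiscreteObjects.Hadamard

open Finset

section inverting
variable {V : Type*} [Fintype V] [DecidableEq V]

omit [Fintype V] [DecidableEq V] in
/-- dihedral relation on points: `ρ τ ρ = τ` gives `ρᵏ (τ (ρᵏ y)) = τ y` for all `k`. -/
theorem inverting_pow_apply (ρ τ : Equiv.Perm V) (hc : ρ * τ * ρ = τ) (k : ℕ) (y : V) :
    (ρ ^ k) (τ ((ρ ^ k) y)) = τ y := by
  induction k generalizing y with
  | zero => simp
  | succ k ih =>
    have h1 : ∀ z, ρ (τ (ρ z)) = τ z := fun z => by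
      have := congrArg (fun g : Equiv.Perm V => g z) hc
      simpa [Equiv.Perm.mul_apply] using this
    calc (ρ ^ (k + 1)) (τ ((ρ ^ (k + 1)) y)) = (ρ ^ k) (ρ (τ (ρ ((ρ ^ k) y)))) := by
          rw [pow_succ, Equiv.Perm.mul_apply, Equiv.Perm.mul_apply, ← perm_pow_apply_comm ρ k]
      _ = (ρ ^ k) (τ ((ρ ^ k) y)) := by rw [h1]
      _ = τ y := ih y

omit [Fintype V] [DecidableEq V] in
/-- **At most one `τ`-fixed point per `⟨ρ⟩`-orbit**: if `τ` inverts `ρ` of odd prime order `p`, `τ y = y` and `ρ y ≠ y`, then no other point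
`ρᵏ y` (`0 < k < p`) of the orbit is fixed by `τ`. -/
theorem inverting_orbit_no_other_fixed (ρ τ : Equiv.Perm V) {p : ℕ} (hp : p.Prime) (hp2 : p ≠ 2) (hρ : ρ ^ p = 1)
    (hc : ρ * τ * ρ = τ) {y : V} (hy : τ y = y) (hρy : ρ y ≠ y) {k : ℕ} (hk0 : 0 < k) (hkp : k < p) :
    τ ((ρ ^ k) y) ≠ (ρ ^ k) y := by
  intro h
  have h2 : (ρ ^ (2 * k)) y = y := by
    have e := inverting_pow_apply ρ τ hc k y
    rw [h, hy, ← Equiv.Perm.mul_apply, ← pow_add] at e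
    rw [two_mul]; exact e
  have hodd : p % 2 = 1 := (Nat.Prime.eq_two_or_odd hp).resolve_left hp2
  by_cases hlt : 2 * k < p
  · exact hρy (perm_fixed_of_pow_fixed ρ hp hρ (by omega) hlt y h2)
  · -- p ≤ 2k < 2p, and 2k ≠ p since p is odd
    have hne : 2 * k ≠ p := fun e => by omega
    have h3 : (ρ ^ (2 * k - p)) y = y := by
      have : ρ ^ (2 * k) = ρ ^ (2 * k - p) * ρ ^ p := by rw [← pow_add, Nat.sub_add_cancel (by omega)]
      rw [this, hρ, mul_one] at h2
      exact h2
    exact hρy (perm_fixed_of_pow_fixed ρ hp hρ (by omega) (by omega) y h3)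

/-- **Counting**: if `τ` inverts `ρ` of odd prime order `p`, then `p · #{y : τ y = y ∧ ρ y ≠ y} ≤ #{y : ρ y ≠ y}` — the `⟨ρ⟩`-orbits of the
`τ`-fixed `ρ`-moved points are pairwise disjoint `p`-sets of `ρ`-moved points. -/
theorem inverting_fixed_moved_bound (ρ τ : Equiv.Perm V) {p : ℕ} (hp : p.Prime) (hp2 : p ≠ 2) (hρ : ρ ^ p = 1)
    (hc : ρ * τ * ρ = τ) :
    p * (univ.filter fun y => τ y = y ∧ ρ y ≠ y).card ≤ (univ.filter fun y => ρ y ≠ y).card := by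
  set T := univ.filter (fun y => τ y = y ∧ ρ y ≠ y) with hT
  set orb : V → Finset V := fun y => (Finset.range p).image (fun k => (ρ ^ k) y) with horb
  have hmemT : ∀ y, y ∈ T ↔ τ y = y ∧ ρ y ≠ y := fun y => by rw [hT, Finset.mem_filter]; simp
  -- each orbit of a point of T has p elements, all ρ-moved
  have hcard : ∀ y ∈ T, (orb y).card = p := fun y hy => by
    simp only [horb]
    rw [Finset.card_image_of_injOn (orbP_injOn ρ hp hρ y ((hmemT y).mp hy).2), Finset.card_range]
  have hsub : ∀ y ∈ T, orb y ⊆ univ.filter (fun y => ρ y ≠ y) := by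
    intro y hy z hz
    obtain ⟨k, -, rfl⟩ := Finset.mem_image.mp hz
    refine Finset.mem_filter.mpr ⟨Finset.mem_univ _, fun h => ((hmemT y).mp hy).2 ?_⟩
    -- ρ (ρ^k y) = ρ^k y ⇒ ρ y = y
    have : (ρ ^ k) (ρ y) = (ρ ^ k) y := by rw [perm_pow_apply_comm]; exact h
    exact (ρ ^ k).injective this
  -- the only point of T in orb y is y itself
  have huniq : ∀ y ∈ T, ∀ k, k < p → (ρ ^ k) y ∈ T → k = 0 := by
    intro y hy k hkp hmem
    by_contra hk0
    exact inverting_orbit_no_other_fixed ρ τ hp hp2 hρ hc ((hmemT y).mp hy).1 ((hmemT y).mp hy).2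
      (Nat.pos_of_ne_zero hk0) hkp ((hmemT _).mp hmem).1
  -- distinct points of T have disjoint orbits
  have hdisj : ∀ y ∈ T, ∀ y' ∈ T, y ≠ y' → Disjoint (orb y) (orb y') := by
    intro y hy y' hy' hne
    rw [Finset.disjoint_left]
    intro z hz hz'
    obtain ⟨a, ha, rfl⟩ := Finset.mem_image.mp hz
    obtain ⟨b, hb, hab⟩ := Finset.mem_image.mp hz'
    rw [Finset.mem_range] at ha hb
    -- y' = ρ^((p - b + a) % p) y lies in orb y ∩ T, so it is y
    have e1 : (ρ ^ (p - b + a)) y = y' := by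
      rw [pow_add, Equiv.Perm.mul_apply, ← hab, ← Equiv.Perm.mul_apply, ← pow_add, Nat.sub_add_cancel hb.le, hρ,
        Equiv.Perm.one_apply]
    have e2 : (ρ ^ ((p - b + a) % p)) y = y' := by rw [← perm_pow_apply_mod ρ hρ]; exact e1
    have hk := huniq y hy _ (Nat.mod_lt _ hp.pos) (by rw [e2]; exact hy')
    rw [hk, pow_zero, Equiv.Perm.one_apply] at e2
    exact hne e2
  -- count
  have hbU : (T.biUnion orb).card = p * T.card := by
    rw [Finset.card_biUnion hdisj, Finset.sum_congr rfl hcard, Finset.sum_const, smul_eq_mul, mul_comm]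
  have hle : (T.biUnion orb).card ≤ (univ.filter fun y => ρ y ≠ y).card :=
    Finset.card_le_card (Finset.biUnion_subset.mpr hsub)
  rw [hbU] at hle
  exact hle

/-- splitting `#Fix τ` along `Fix ρ`: `#Fix τ ≤ #Fix ρ + #{τ y = y ∧ ρ y ≠ y}` and `#{ρ y ≠ y} = |V| − #Fix ρ`. -/
private theorem fixed_split_le (ρ τ : Equiv.Perm V) :
    (univ.filter fun y => τ y = y).card ≤
      (univ.filter fun y => ρ y = y).card + (univ.filter fun y => τ y = y ∧ ρ y ≠ y).card ∧
    (univ.filter fun y => ρ y ≠ y).card + (univ.filter fun y => ρ y = y).card = Fintype.card V := by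
  constructor
  · have hsub : (univ.filter fun y => τ y = y) ⊆
        (univ.filter fun y => ρ y = y) ∪ (univ.filter fun y => τ y = y ∧ ρ y ≠ y) := by
      intro y hy
      rw [Finset.mem_union, Finset.mem_filter, Finset.mem_filter]
      have hτy := (Finset.mem_filter.mp hy).2
      by_cases h : ρ y = y
      · exact Or.inl ⟨Finset.mem_univ _, h⟩
      · exact Or.inr ⟨Finset.mem_univ _, hτy, h⟩
    exact (Finset.card_le_card hsub).trans (Finset.card_union_le _ _)
  · have h := Finset.card_filter_add_card_filter_not (s := (univ : Finset V)) (fun y => ρ y ≠ y)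
    rw [Finset.card_univ] at h
    have e : (univ.filter fun y => ¬ (ρ y ≠ y)) = univ.filter fun y => ρ y = y :=
      Finset.filter_congr fun y _ => by simp
    rw [e] at h
    exact h

/-- **Involution inverting an element of order `83`: `#Fix τ ∈ {1, 5}`** (`1 + r`, `r ∈ {0, 4}` invariant `83`-orbits). -/
theorem involution_inverting_order83_fixed (hV : Fintype.card V = 333) (A : Matrix V V ℤ)
    (h01 : ∀ x y, A x y = 0 ∨ A x y = 1) (hsymm : ∀ x y, A y x = A x y) (hdiag : ∀ x, A x x = 0)
    (hk : ∀ x, ∑ y, A x y = 166) (hsrg : ∀ x y, ∑ z, A x z * A z y = 83 * (1 + (if x = y then 1 else 0)) - A x y)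
    (ρ τ : Equiv.Perm V) (hρ : ρ ^ 83 = 1) (hρ1 : ρ ≠ 1) (hτ : ∀ x, τ (τ x) = x) (hc : ρ * τ * ρ = τ)
    (hAρ : ∀ x y, A (ρ x) (ρ y) = A x y) (hAτ : ∀ x y, A (τ x) (τ y) = A x y) :
    (univ.filter fun x => τ x = x).card = 1 ∨ (univ.filter fun x => τ x = x).card = 5 := by
  have hp : Nat.Prime 83 := by norm_num
  obtain ⟨-, -, -, -, -, -, -, -, -, w83⟩ := aut_prime_windows_refined hV A h01 hsymm hdiag hk hsrg hp (by norm_num) ρ hρ hρ1 hAρ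
  have hf83 : (univ.filter fun y => ρ y = y).card = 1 := w83 rfl
  have hb := inverting_fixed_moved_bound ρ τ hp (by norm_num) hρ hc
  obtain ⟨hs1, hs2⟩ := fixed_split_le ρ τ
  rw [hV] at hs2
  have hm4 := involution_fixedPoints_mod_four hV A h01 hsymm hdiag hk hsrg τ hτ hAτ
  omega

/-- **Involution inverting an element of order `41`: `#Fix τ ∈ {1, 5, 9, 13}`.** -/
theorem involution_inverting_order41_fixed (hV : Fintype.card V = 333) (A : Matrix V V ℤ)
    (h01 : ∀ x y, A x y = 0 ∨ A x y = 1) (hsymm : ∀ x y, A y x = A x y) (hdiag : ∀ x, A x x = 0)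
    (hk : ∀ x, ∑ y, A x y = 166) (hsrg : ∀ x y, ∑ z, A x z * A z y = 83 * (1 + (if x = y then 1 else 0)) - A x y)
    (ρ τ : Equiv.Perm V) (hρ : ρ ^ 41 = 1) (hρ1 : ρ ≠ 1) (hτ : ∀ x, τ (τ x) = x) (hc : ρ * τ * ρ = τ)
    (hAρ : ∀ x y, A (ρ x) (ρ y) = A x y) (hAτ : ∀ x y, A (τ x) (τ y) = A x y) :
    (univ.filter fun x => τ x = x).card = 1 ∨ (univ.filter fun x => τ x = x).card = 5 ∨
      (univ.filter fun x => τ x = x).card = 9 ∨ (univ.filter fun x => τ x = x).card = 13 := by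
  have hp : Nat.Prime 41 := by norm_num
  obtain ⟨-, -, -, -, -, -, -, -, w41, -⟩ := aut_prime_windows_refined hV A h01 hsymm hdiag hk hsrg hp (by norm_num) ρ hρ hρ1 hAρ
  have hf41 : (univ.filter fun y => ρ y = y).card = 5 := w41 rfl
  have hb := inverting_fixed_moved_bound ρ τ hp (by norm_num) hρ hc
  obtain ⟨hs1, hs2⟩ := fixed_split_le ρ τ
  rw [hV] at hs2
  have hm4 := involution_fixedPoints_mod_four hV A h01 hsymm hdiag hk hsrg τ hτ hAτ
  omega

/-- **Involution inverting an element of order `37`: `#Fix τ ∈ {1, 5, 9}`.** -/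
theorem involution_inverting_order37_fixed (hV : Fintype.card V = 333) (A : Matrix V V ℤ)
    (h01 : ∀ x y, A x y = 0 ∨ A x y = 1) (hsymm : ∀ x y, A y x = A x y) (hdiag : ∀ x, A x x = 0)
    (hk : ∀ x, ∑ y, A x y = 166) (hsrg : ∀ x y, ∑ z, A x z * A z y = 83 * (1 + (if x = y then 1 else 0)) - A x y)
    (ρ τ : Equiv.Perm V) (hρ : ρ ^ 37 = 1) (hρ1 : ρ ≠ 1) (hτ : ∀ x, τ (τ x) = x) (hc : ρ * τ * ρ = τ)
    (hAρ : ∀ x y, A (ρ x) (ρ y) = A x y) (hAτ : ∀ x y, A (τ x) (τ y) = A x y) :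
    (univ.filter fun x => τ x = x).card = 1 ∨ (univ.filter fun x => τ x = x).card = 5 ∨
      (univ.filter fun x => τ x = x).card = 9 := by
  have hp : Nat.Prime 37 := by norm_num
  obtain ⟨-, -, -, -, -, -, -, w37, -, -⟩ := aut_prime_windows_refined hV A h01 hsymm hdiag hk hsrg hp (by norm_num) ρ hρ hρ1 hAρ
  have hf37 : (univ.filter fun y => ρ y = y).card = 0 := w37 rfl
  have hb := inverting_fixed_moved_bound ρ τ hp (by norm_num) hρ hc
  obtain ⟨hs1, hs2⟩ := fixed_split_le ρ τ
  rw [hV] at hs2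
  have hm4 := involution_fixedPoints_mod_four hV A h01 hsymm hdiag hk hsrg τ hτ hAτ
  omega

/-- **Involution inverting an element of order `11`: `#Fix τ ≤ 53`** (`#Fix ρ = 25`, `28` orbits). -/
theorem involution_inverting_order11_fixed (hV : Fintype.card V = 333) (A : Matrix V V ℤ)
    (h01 : ∀ x y, A x y = 0 ∨ A x y = 1) (hsymm : ∀ x y, A y x = A x y) (hdiag : ∀ x, A x x = 0)
    (hk : ∀ x, ∑ y, A x y = 166) (hsrg : ∀ x y, ∑ z, A x z * A z y = 83 * (1 + (if x = y then 1 else 0)) - A x y)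
    (ρ τ : Equiv.Perm V) (hρ : ρ ^ 11 = 1) (hρ1 : ρ ≠ 1) (hc : ρ * τ * ρ = τ)
    (hAρ : ∀ x y, A (ρ x) (ρ y) = A x y) :
    (univ.filter fun x => τ x = x).card ≤ 53 := by
  have hp : Nat.Prime 11 := by norm_num
  have hf11 := aut_order11_fixed hV A h01 hsymm hdiag hk hsrg ρ hρ hρ1 hAρ
  have hb := inverting_fixed_moved_bound ρ τ hp (by norm_num) hρ hc
  obtain ⟨hs1, hs2⟩ := fixed_split_le ρ τ
  rw [hV] at hs2
  omega

end inverting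

end Summit.Ventures.DiscreteObjects.Hadamard
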